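import Summits.FinalStateConjecture.FinalStateConjecture.Theorems.EIHFluxBalanceInertialRecessionCalculus
import Literature.Geometry.Lorentzian.BilinPullbackEstimates

/-!
# Route EIHFluxBalance — `ModulatedKerrHandoff`, line `swallow-transfer`: the `Cᵐ` estimate of a time-shift deviation (part 4)

Helper file for the crux `stmt-FinalStateConjecture-10167`
(`Summit.FinalStateConjecture.FinalStateConjecture.Theses.EIHFluxBalance.ModulatedKerrHandoff`), stub
`stub_bentLabDeviation` of the line `swallow-transfer`.

Generic calculus of the coordinate deviation `e = f^*g − g` of a field of bilinear forms `g` on `E4`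
under a TIME SHIFT `f(y) = y + S(y) e₀` by a scalar function `S`, when `g` is stationary
(`g(y + s e₀) = g(y)`, as the Kerr–Schild form is: `Kerr.bilin_add_time`). Then `Df = 1 + e₀ ⊗ dS`
and `g(f y) = g(y)`, so
`e(y)(v, w) = dS(v) g(e₀, w) + g(v, e₀) dS(w) + g(e₀, e₀) dS(v) dS(w)` — a sum of products of the
scalar slots `y ↦ dS_y(v)`, `y ↦ g_y(e₀, w)`, `y ↦ g_y(v, e₀)`, `y ↦ g_y(e₀, e₀)`. Leibniz
(`norm_iteratedFDerivWithin_mul_le`) and the recovery of the operator norm of `Dᵐ e` from scalar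
evaluations (`norm_iteratedFDeriv_le_of_forall_apply₂`) give the registered sub-goal of this file
`bentLabDeviation_shiftDeviation_estimate`: if `‖Dʲg(x)‖ ≤ N` (`j ≤ m`) and `‖DⁱS(x)‖ ≤ ε ≤ 1`
(`1 ≤ i ≤ m + 1`) then `‖Dᵐ e(x)‖ ≤ 3 · 4ᵐ · N · ε`. [folklore]
-/

-- `Summit.FinalStateConjecture.FinalStateConjecture.…` is the summit's mandated namespace (summit = problem name)
set_option linter.dupNamespace false

noncomputable section

open Set Filter Topology Function
open scoped ContDiff Topology
open Literature.Geometry.Lorentzian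

namespace Summit.FinalStateConjecture.FinalStateConjecture.Theorems.BentLabDeviation

/-! ### Scalar slots -/

section Slots

variable {V : Set E4} {x : E4}

/-- `‖e₀‖ = 1`. [folklore] -/
theorem norm_basisVector_zero : ‖(E4.basisVector 0 : E4)‖ = 1 := by
  show ‖(PiLp.single 2 (0 : Fin 4) (1 : ℝ) : E4)‖ = 1
  rw [PiLp.norm_single, norm_one]

/-- Slot of the shift's differential: `‖Dⁱ(y ↦ dS_y(v))(x)‖ ≤ ‖v‖ ‖Dⁱ⁺¹S(x)‖` on an open set.
[folklore] -/
theorem norm_iteratedFDerivWithin_fderiv_apply_le (hV : IsOpen V) {S : E4 → ℝ}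
    (hS : ContDiffOn ℝ ∞ S V) (hx : x ∈ V) (v : E4) (i : ℕ) :
    ‖iteratedFDerivWithin ℝ i (fun y ↦ fderiv ℝ S y v) V x‖ ≤
      ‖v‖ * ‖iteratedFDeriv ℝ (i + 1) S x‖ := by
  have hθ : ContDiffOn ℝ ∞ (fderiv ℝ S) V := hS.fderiv_of_isOpen hV (by simp)
  calc ‖iteratedFDerivWithin ℝ i (fun y ↦ fderiv ℝ S y v) V x‖
      ≤ ‖v‖ * ‖iteratedFDerivWithin ℝ i (fderiv ℝ S) V x‖ :=
        norm_iteratedFDerivWithin_clm_apply_const (hθ x hx) hV.uniqueDiffOn hx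
          (by exact_mod_cast le_top)
    _ = ‖v‖ * ‖iteratedFDeriv ℝ (i + 1) S x‖ := by
        rw [iteratedFDerivWithin_of_isOpen i hV hx, norm_iteratedFDeriv_fderiv_of_isOpen hV hx i]

/-- Slot of the form: `‖Dʲ(y ↦ g_y(u, v))(x)‖ ≤ ‖u‖ ‖v‖ ‖Dʲg(x)‖` on an open set. [folklore] -/
theorem norm_iteratedFDerivWithin_apply₂_le (hV : IsOpen V) {g : E4 → E4 →L[ℝ] E4 →L[ℝ] ℝ}
    (hg : ContDiffOn ℝ ∞ g V) (hx : x ∈ V) (u v : E4) (j : ℕ) :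
    ‖iteratedFDerivWithin ℝ j (fun y ↦ g y u v) V x‖ ≤ ‖u‖ * ‖v‖ * ‖iteratedFDeriv ℝ j g x‖ := by
  have hgu : ContDiffOn ℝ ∞ (fun y ↦ g y u) V := hg.clm_apply contDiffOn_const
  have h1 : ‖iteratedFDerivWithin ℝ j (fun y ↦ g y u v) V x‖ ≤
      ‖v‖ * ‖iteratedFDerivWithin ℝ j (fun y ↦ g y u) V x‖ :=
    norm_iteratedFDerivWithin_clm_apply_const (hgu x hx) hV.uniqueDiffOn hx (by exact_mod_cast le_top)
  have h2 : ‖iteratedFDerivWithin ℝ j (fun y ↦ g y u) V x‖ ≤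
      ‖u‖ * ‖iteratedFDerivWithin ℝ j g V x‖ :=
    norm_iteratedFDerivWithin_clm_apply_const (hg x hx) hV.uniqueDiffOn hx (by exact_mod_cast le_top)
  rw [iteratedFDerivWithin_of_isOpen (f := g) j hV hx] at h2
  calc ‖iteratedFDerivWithin ℝ j (fun y ↦ g y u v) V x‖
      ≤ ‖v‖ * (‖u‖ * ‖iteratedFDeriv ℝ j g x‖) :=
        h1.trans (mul_le_mul_of_nonneg_left h2 (norm_nonneg v))
    _ = ‖u‖ * ‖v‖ * ‖iteratedFDeriv ℝ j g x‖ := by ring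

/-- Leibniz for a product of two scalar slots with uniform bounds `α`, `β` on the orders involved:
`‖Dⁿ(a · b)(x)‖ ≤ 2ⁿ α β`. [folklore] -/
theorem norm_iteratedFDerivWithin_mul_le_of_bounds (hV : IsOpen V) {a b : E4 → ℝ}
    (ha : ContDiffOn ℝ ∞ a V) (hb : ContDiffOn ℝ ∞ b V) (hx : x ∈ V) {n : ℕ} {α β : ℝ}
    (hα : 0 ≤ α) (hαb : ∀ i ≤ n, ‖iteratedFDerivWithin ℝ i a V x‖ ≤ α)
    (hβb : ∀ i ≤ n, ‖iteratedFDerivWithin ℝ i b V x‖ ≤ β) :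
    ‖iteratedFDerivWithin ℝ n (fun y ↦ a y * b y) V x‖ ≤ 2 ^ n * α * β := by
  have h := norm_iteratedFDerivWithin_mul_le (n := n) ha hb hV.uniqueDiffOn hx
    (by exact_mod_cast le_top)
  exact h.trans (sum_choose_mul_mul_le hα hαb (fun _ ↦ norm_nonneg _) hβb)

end Slots

/-! ### The time-shift deviation -/

section ShiftDeviation

variable {S : E4 → ℝ} {g : E4 → E4 →L[ℝ] E4 →L[ℝ] ℝ} {V : Set E4}

/-- The differential of the time shift `f(y) = y + S(y) e₀` is `1 + e₀ ⊗ dS`. [folklore] -/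
theorem hasFDerivAt_timeShift (hV : IsOpen V) (hS : ContDiffOn ℝ ∞ S V) {y : E4} (hy : y ∈ V) :
    HasFDerivAt (fun y : E4 ↦ y + S y • E4.basisVector 0)
      (ContinuousLinearMap.id ℝ E4 + (fderiv ℝ S y).smulRight (E4.basisVector 0)) y := by
  have hd : DifferentiableAt ℝ S y :=
    (hS.differentiableOn (by simp)).differentiableAt (hV.mem_nhds hy)
  exact (hasFDerivAt_id y).add (hd.hasFDerivAt.smul_const _)

/-- The time shift is `C^∞` on `V`. [folklore] -/
theorem contDiffOn_timeShift (hS : ContDiffOn ℝ ∞ S V) :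
    ContDiffOn ℝ ∞ (fun y : E4 ↦ y + S y • E4.basisVector 0) V :=
  contDiffOn_id.add (hS.smul contDiffOn_const)

/-- **Scalar evaluation of the time-shift deviation.** For stationary `g`,
`e(y)(v, w) = dS(v) g(e₀, w) + g(v, e₀) dS(w) + g(e₀, e₀) dS(v) dS(w)` on `V`. [folklore] -/
theorem shiftDeviation_apply (hV : IsOpen V) (hS : ContDiffOn ℝ ∞ S V)
    (hstat : ∀ y ∈ V, g (y + S y • E4.basisVector 0) = g y) {y : E4} (hy : y ∈ V) (v w : E4) :
    ((g (y + S y • E4.basisVector 0)).bilinearComp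
        (fderiv ℝ (fun y : E4 ↦ y + S y • E4.basisVector 0) y)
        (fderiv ℝ (fun y : E4 ↦ y + S y • E4.basisVector 0) y) - g y) v w =
      fderiv ℝ S y v * g y (E4.basisVector 0) w + g y v (E4.basisVector 0) * fderiv ℝ S y w +
        g y (E4.basisVector 0) (E4.basisVector 0) * (fderiv ℝ S y v * fderiv ℝ S y w) := by
  rw [hstat y hy, (hasFDerivAt_timeShift hV hS hy).fderiv]
  simp only [sub_apply, ContinuousLinearMap.bilinearComp_apply, add_apply,
    ContinuousLinearMap.id_apply, ContinuousLinearMap.smulRight_apply, map_add, map_smul,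
    smul_apply, smul_eq_mul]
  ring

/-- The time-shift deviation is `C^∞` on `V` (for stationary `g`). [folklore] -/
theorem contDiffOn_shiftDeviation (hV : IsOpen V) (hS : ContDiffOn ℝ ∞ S V)
    (hg : ContDiffOn ℝ ∞ g V) (hstat : ∀ y ∈ V, g (y + S y • E4.basisVector 0) = g y) :
    ContDiffOn ℝ ∞ (fun y ↦ (g (y + S y • E4.basisVector 0)).bilinearComp
        (fderiv ℝ (fun y : E4 ↦ y + S y • E4.basisVector 0) y)
        (fderiv ℝ (fun y : E4 ↦ y + S y • E4.basisVector 0) y) - g y) V := by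
  have hgf : ContDiffOn ℝ ∞ (fun y ↦ g (y + S y • E4.basisVector 0)) V :=
    hg.congr fun y hy ↦ hstat y hy
  have hfd : ContDiffOn ℝ ∞ (fderiv ℝ (fun y : E4 ↦ y + S y • E4.basisVector 0)) V :=
    (contDiffOn_timeShift hS).fderiv_of_isOpen hV (by simp)
  intro y hy
  exact (contDiffWithinAt_bilinearComp_self (hgf y hy) (hfd y hy)).sub (hg y hy)

/-- **The `Cᵐ` estimate of the time-shift deviation** (registered sub-goal of this file). Let `S` and a
STATIONARY field of bilinear forms `g` (`g(y + S(y)e₀) = g(y)`) be `C^∞` on an open set `V ∋ x`, with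
`‖Dʲg(x)‖ ≤ N` for `j ≤ m` and `‖DⁱS(x)‖ ≤ ε ≤ 1` for `1 ≤ i ≤ m + 1`. Then the coordinate deviation
`e = f^*g − g` of the time shift `f(y) = y + S(y)e₀` has `‖Dᵐe(x)‖ ≤ 3 · 4ᵐ N ε`. [folklore] -/
theorem bentLabDeviation_shiftDeviation_estimate : open Literature.Geometry.Lorentzian in ∀ {S : E4 → ℝ} {g : E4 → E4 →L[ℝ] E4 →L[ℝ] ℝ} {V : Set E4}, IsOpen V → ContDiffOn ℝ ((⊤ : ℕ∞) : WithTop ℕ∞) S V → ContDiffOn ℝ ((⊤ : ℕ∞) : WithTop ℕ∞) g V → (∀ y ∈ V, g (y + S y • E4.basisVector 0) = g y) → ∀ {x : E4}, x ∈ V → ∀ (m : ℕ) {N ε : ℝ}, 0 ≤ N → 0 ≤ ε → ε ≤ 1 → (∀ j ≤ m, ‖iteratedFDeriv ℝ j g x‖ ≤ N) → (∀ i, 1 ≤ i → i ≤ m + 1 → ‖iteratedFDeriv ℝ i S x‖ ≤ ε) → ‖iteratedFDeriv ℝ m (fun y ↦ (g (y + S y • E4.basisVector 0)).bilinearComp (fderiv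 ℝ (fun y : E4 ↦ y + S y • E4.basisVector 0) y) (fderiv ℝ (fun y : E4 ↦ y + S y • E4.basisVector 0) y) - g y) x‖ ≤ 3 * 4 ^ m * N * ε := by
  intro S g V hV hS hg hstat x hx m N ε hN0 hε0 hε1 hN hε
  set e0 : E4 := E4.basisVector 0 with he0
  have he0n : ‖e0‖ = 1 := norm_basisVector_zero
  -- the scalar slots and their smoothness on `V`
  have hθ : ContDiffOn ℝ ∞ (fderiv ℝ S) V := hS.fderiv_of_isOpen hV (by simp)
  have ha : ∀ v : E4, ContDiffOn ℝ ∞ (fun y ↦ fderiv ℝ S y v) V := fun v ↦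
    hθ.clm_apply contDiffOn_const
  have hb : ∀ u v : E4, ContDiffOn ℝ ∞ (fun y ↦ g y u v) V := fun u v ↦
    (hg.clm_apply contDiffOn_const).clm_apply contDiffOn_const
  -- slot bounds
  have hab : ∀ (v : E4) (i : ℕ), i ≤ m →
      ‖iteratedFDerivWithin ℝ i (fun y ↦ fderiv ℝ S y v) V x‖ ≤ ‖v‖ * ε := by
    intro v i hi
    refine (norm_iteratedFDerivWithin_fderiv_apply_le hV hS hx v i).trans ?_
    exact mul_le_mul_of_nonneg_left (hε (i + 1) (by omega) (by omega)) (norm_nonneg v)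
  have hbb : ∀ (u v : E4) (j : ℕ), j ≤ m →
      ‖iteratedFDerivWithin ℝ j (fun y ↦ g y u v) V x‖ ≤ ‖u‖ * ‖v‖ * N := by
    intro u v j hj
    refine (norm_iteratedFDerivWithin_apply₂_le hV hg hx u v j).trans ?_
    exact mul_le_mul_of_nonneg_left (hN j hj) (by positivity)
  -- the three terms of the scalar evaluation
  have hT1 : ∀ v w : E4, ‖iteratedFDerivWithin ℝ m
      (fun y ↦ fderiv ℝ S y v * g y e0 w) V x‖ ≤ 2 ^ m * (‖v‖ * ε) * (‖w‖ * N) := by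
    intro v w
    refine norm_iteratedFDerivWithin_mul_le_of_bounds hV (ha v) (hb e0 w) hx (by positivity)
      (fun i hi ↦ hab v i hi) (fun i hi ↦ ?_)
    calc ‖iteratedFDerivWithin ℝ i (fun y ↦ g y e0 w) V x‖ ≤ ‖e0‖ * ‖w‖ * N := hbb e0 w i hi
      _ = ‖w‖ * N := by rw [he0n, one_mul]
  have hT2 : ∀ v w : E4, ‖iteratedFDerivWithin ℝ m
      (fun y ↦ g y v e0 * fderiv ℝ S y w) V x‖ ≤ 2 ^ m * (‖v‖ * N) * (‖w‖ * ε) := by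
    intro v w
    refine norm_iteratedFDerivWithin_mul_le_of_bounds hV (hb v e0) (ha w) hx (by positivity)
      (fun i hi ↦ ?_) (fun i hi ↦ hab w i hi)
    calc ‖iteratedFDerivWithin ℝ i (fun y ↦ g y v e0) V x‖ ≤ ‖v‖ * ‖e0‖ * N := hbb v e0 i hi
      _ = ‖v‖ * N := by rw [he0n, mul_one]
  have hT3 : ∀ v w : E4, ‖iteratedFDerivWithin ℝ m
      (fun y ↦ g y e0 e0 * (fderiv ℝ S y v * fderiv ℝ S y w)) V x‖ ≤
        2 ^ m * N * (2 ^ m * (‖v‖ * ε) * (‖w‖ * ε)) := by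
    intro v w
    refine norm_iteratedFDerivWithin_mul_le_of_bounds hV (hb e0 e0) ((ha v).mul (ha w)) hx hN0
      (fun i hi ↦ ?_) (fun i hi ↦ ?_)
    · calc ‖iteratedFDerivWithin ℝ i (fun y ↦ g y e0 e0) V x‖ ≤ ‖e0‖ * ‖e0‖ * N := hbb e0 e0 i hi
        _ = N := by rw [he0n, one_mul, one_mul]
    · refine (norm_iteratedFDerivWithin_mul_le_of_bounds hV (ha v) (ha w) hx (by positivity)
        (fun k hk ↦ hab v k (hk.trans hi)) (fun k hk ↦ hab w k (hk.trans hi))).trans ?_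
      have h2 : (2 : ℝ) ^ i ≤ 2 ^ m := pow_le_pow_right₀ (by norm_num) hi
      have h3 : 0 ≤ (‖v‖ * ε) * (‖w‖ * ε) := by positivity
      nlinarith
  -- the scalar evaluations of the deviation
  set e : E4 → E4 →L[ℝ] E4 →L[ℝ] ℝ := fun y ↦ (g (y + S y • e0)).bilinearComp
    (fderiv ℝ (fun y : E4 ↦ y + S y • e0) y) (fderiv ℝ (fun y : E4 ↦ y + S y • e0) y) - g y
    with he
  have hecd : ContDiffOn ℝ ∞ e V := contDiffOn_shiftDeviation hV hS hg hstat
  have heAt : ContDiffAt ℝ m e x :=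
    ((hecd x hx).contDiffAt (hV.mem_nhds hx)).of_le (by exact_mod_cast le_top)
  have hscalar : ∀ v w : E4,
      ‖iteratedFDeriv ℝ m (fun y ↦ e y v w) x‖ ≤ 3 * 4 ^ m * N * ε * ‖v‖ * ‖w‖ := by
    intro v w
    have hev : (fun y ↦ e y v w) =ᶠ[𝓝 x] fun y ↦
        fderiv ℝ S y v * g y e0 w + g y v e0 * fderiv ℝ S y w +
          g y e0 e0 * (fderiv ℝ S y v * fderiv ℝ S y w) := by
      filter_upwards [hV.mem_nhds hx] with y hy
      exact shiftDeviation_apply hV hS hstat hy v w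
    rw [(hev.iteratedFDeriv ℝ m).eq_of_nhds, ← iteratedFDerivWithin_of_isOpen m hV hx]
    have hA1 : ContDiffOn ℝ ∞ (fun y ↦ fderiv ℝ S y v * g y e0 w) V := (ha v).mul (hb e0 w)
    have hA2 : ContDiffOn ℝ ∞ (fun y ↦ g y v e0 * fderiv ℝ S y w) V := (hb v e0).mul (ha w)
    have hA3 : ContDiffOn ℝ ∞ (fun y ↦ g y e0 e0 * (fderiv ℝ S y v * fderiv ℝ S y w)) V :=
      (hb e0 e0).mul ((ha v).mul (ha w))
    have hsum : (fun y ↦ fderiv ℝ S y v * g y e0 w + g y v e0 * fderiv ℝ S y w +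
          g y e0 e0 * (fderiv ℝ S y v * fderiv ℝ S y w)) =
        ((fun y ↦ fderiv ℝ S y v * g y e0 w) + fun y ↦ g y v e0 * fderiv ℝ S y w) +
          fun y ↦ g y e0 e0 * (fderiv ℝ S y v * fderiv ℝ S y w) := rfl
    have hle : (m : WithTop ℕ∞) ≤ ∞ := by exact_mod_cast le_top
    rw [hsum, iteratedFDerivWithin_add_apply
      (f := (fun y ↦ fderiv ℝ S y v * g y e0 w) + fun y ↦ g y v e0 * fderiv ℝ S y w)
      (g := fun y ↦ g y e0 e0 * (fderiv ℝ S y v * fderiv ℝ S y w))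
      (((hA1.add hA2) x hx).of_le hle) ((hA3 x hx).of_le hle) hV.uniqueDiffOn hx,
      iteratedFDerivWithin_add_apply (f := fun y ↦ fderiv ℝ S y v * g y e0 w)
      (g := fun y ↦ g y v e0 * fderiv ℝ S y w) ((hA1 x hx).of_le hle)
      ((hA2 x hx).of_le hle) hV.uniqueDiffOn hx]
    refine (norm_add_le _ _).trans ((add_le_add ((norm_add_le _ _).trans
      (add_le_add (hT1 v w) (hT2 v w))) (hT3 v w)).trans ?_)
    have h2m : (2 : ℝ) ^ m ≤ 4 ^ m := pow_le_pow_left₀ (by norm_num) (by norm_num) m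
    have h4 : (2 : ℝ) ^ m * 2 ^ m = 4 ^ m := by rw [← mul_pow]; norm_num
    have hε2 : ε * ε ≤ ε := by nlinarith
    have hX : 0 ≤ N * ε * (‖v‖ * ‖w‖) := by positivity
    have hP : 0 ≤ (4 : ℝ) ^ m * N * (‖v‖ * ‖w‖) := by positivity
    calc 2 ^ m * (‖v‖ * ε) * (‖w‖ * N) + 2 ^ m * (‖v‖ * N) * (‖w‖ * ε) +
          2 ^ m * N * (2 ^ m * (‖v‖ * ε) * (‖w‖ * ε))
        = 2 ^ m * (N * ε * (‖v‖ * ‖w‖)) + 2 ^ m * (N * ε * (‖v‖ * ‖w‖)) +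
            (2 ^ m * 2 ^ m) * N * (‖v‖ * ‖w‖) * (ε * ε) := by ring
      _ ≤ 4 ^ m * (N * ε * (‖v‖ * ‖w‖)) + 4 ^ m * (N * ε * (‖v‖ * ‖w‖)) +
            4 ^ m * N * (‖v‖ * ‖w‖) * ε := by
          rw [h4]
          exact add_le_add (add_le_add (mul_le_mul_of_nonneg_right h2m hX)
            (mul_le_mul_of_nonneg_right h2m hX)) (mul_le_mul_of_nonneg_left hε2 hP)
      _ = 3 * 4 ^ m * N * ε * ‖v‖ * ‖w‖ := by ring
  have hfin := norm_iteratedFDeriv_le_of_forall_apply₂ heAt (by positivity) hscalar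
  simpa only [he, he0] using hfin

end ShiftDeviation

end Summit.FinalStateConjecture.FinalStateConjecture.Theorems.BentLabDeviation

end
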